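import Summits.BirchSwinnertonDyer.BirchSwinnertonDyer.Theorems.SchneiderFreeAdditiveX3ControlGlobalPTorsionF
import HarnessLib

/-!
# Crux `AnticycControlAdditiveK` (route `SchneiderFreeAdditiveX3`, item stmt-BirchSwinnertonDyer-19295):
# the registered stub `stub_baseCountTors` (P6-add-tors, skeleton v3-K c0242a50) FROM THE CITED FACTS —
# every frame, any global torsion `g`, any local torsion `t`

Seat `bsd-schneider-door-c6`, gen 2 (cell `bsd-schneider-ideate`). The last open stub of the v3-K
«torsAtoms» skeleton of crux 19295: for all `g t` with `#ker res = p^g`, `#ker r_𝔭 = p^t`,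
`#Sel_𝔭(K, E[p^∞]) = p^a` with `a = ord_p #Ш + 2(ord_p log_ω P − ord_p [E(K):ℤP]) + ord_p ∏_{w∣p} c_w + g − t`.
As REGISTERED (Kolyvagin prefix only) it is F2-under-typed, like `stub_ptSurj` / `stub_coinv` (gen 0
FINDING): the count consumes Poitou–Tate duality for Selmer structures (JSW17 Prop. 3.2.1 via Milne I
4.10), the identification `t = t_p` consumes Fin_v (route item `LocalTowerTorsionFiniteX3`,
stmt-BirchSwinnertonDyer-19546) and Brink's Cor. 1 above `p`, none of which the prefix supplies. Here:

* **`stub_baseCountTors_of_facts`** — the registered signature VERBATIM ⇐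
  (∀ K, `poitouTate_selmerStructure_duality K`) + (∀ K p, Brink `decomp_not_le_kerSubgroup_above_of_isAnticyclotomic`)
  + the statement of item 19546 (`…Theses.SchneiderFreeAdditiveX3.LocalTowerTorsionFiniteX3`): the
  torsion-general exact count `additiveBaseSelmerCountTors_of_rankOne_anyTorsion` (door-c4 g3 assembly on
  this seat's engine p439956 / indices p442789 · p442942 and door-c4 g3's level/limit p440640) gives
  `#Sel·#E(ℚ_p)[p^∞] = p^{a₀}`, `a₀ = … + ord_p #E(K)[p^∞]`; `p^g = #ker res = #E(K)[p^∞]` (door-c4 gen 0 +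
  door-c5 + Galois descent) and `p^t = #ker r_𝔭 = #E(ℚ_p)[p^∞]` (door-c4 gen 2, Fin_v + Brink) turn it into
  the stub's `… + g − t`.
* `anticycControlAdditiveK_of_facts_of_finV` — hence the crux decl `AnticycControlAdditiveK` itself ⇐
  the same facts + (∀ K, PT for Ш) + Brink Thm. 2 + item 19546 (gen 0's
  `anticycControlAdditiveK_of_facts_of_baseCountTors`).

CONDITIONAL (hypotheses BY NAME); no `Prop` fact minted; closes nothing by itself; BSD is not proved by
any of this.

References: [JetchevSkinnerWan2017] Prop. 3.2.1, Thm. 3.3.1 (arXiv:1512.06894 pp. 10–11); [KellerYin2024]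
App. B Thm. B.0.6; [MilneADT2006] I 4.10, 2.8; [Brink2007] Thm. 2, Cor. 1; [GreenbergLNM1716] §3, §5.
-/

noncomputable section

open scoped Classical

open Field NumberField IsDedekindDomain WeierstrassCurve
open Literature.NumberTheory.EllipticCurves Literature.NumberTheory.EllipticCurves.GreenbergSelmer
open Literature.NumberTheory.GaloisRepresentations
open Literature.NumberTheory.GaloisCohomology
open Literature.NumberTheory.EllipticCurves.ModularForms
  Literature.NumberTheory.EllipticCurves.Rank1Residual
  Literature.NumberTheory.EllipticCurves.Rank1Residual.Typed
  Summit.BirchSwinnertonDyer.Rank1Residual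
  Summit.BirchSwinnertonDyer.Rank1Residual.X11b
  Summit.BirchSwinnertonDyer.Rank1Residual.X11b.AcSelmer
  Summit.BirchSwinnertonDyer.Rank1Residual.X11b.LocBridge

set_option linter.dupNamespace false

namespace Summit.BirchSwinnertonDyer.BirchSwinnertonDyer.Theorems.SchneiderFreeAdditiveX3

section StubBaseCountTors

open Summit.BirchSwinnertonDyer.BirchSwinnertonDyer.Theses.SchneiderFreeAdditiveX3
  Summit.BirchSwinnertonDyer.BirchSwinnertonDyer.Theorems.SchneiderFree
  Summit.BirchSwinnertonDyer.BirchSwinnertonDyer.Theorems.SchneiderFreeControlAtoms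

/-- **The registered stub `stub_baseCountTors` of crux `AnticycControlAdditiveK` (skeleton v3-K,
signature VERBATIM as the conclusion) from the cited Poitou–Tate duality for Selmer structures, Brink's
Cor. 1 above `p`, and Fin_v on the cell (the statement of route item `LocalTowerTorsionFiniteX3`).** At every
frame and for the ACTUAL exponents `g`, `t` (`#ker res = p^g`, `#ker r_𝔭 = p^t`):
`#Sel_𝔭(K,E[p^∞]) = p^a`, `a = ord_p #Ш[p^∞] + 2(ord_p log_ω P − ord_p [E(K):ℤP]) + ord_p ∏_{w∣p} c_w + g − t`.
[cite: JetchevSkinnerWan2017, Prop. 3.2.1 and Thm. 3.3.1 (arXiv:1512.06894 pp. 10–11)]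
[cite: KellerYin2024, App. B Thm. B.0.6 (arXiv:2402.12781 pp. 29–30)] [cite: MilneADT2006, Ch. I, Thm. 4.10(b) and Thm. 2.8]
[cite: Brink2007, Cor. 1] [cite: GreenbergLNM1716, §3 Lemma 3.3 and §5 Prop. 5.8] -/
theorem stub_baseCountTors_of_facts
    (hPT : ∀ (K : Type) [Field K] [NumberField K], poitouTate_selmerStructure_duality K)
    (hBrA : ∀ (K : Type) [Field K] [NumberField K] (p : ℕ) [Fact p.Prime],
      ZpExtension.decomp_not_le_kerSubgroup_above_of_isAnticyclotomic K p)
    (hFinV : LocalTowerTorsionFiniteX3) :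
    (∀ (N : ℕ) [NeZero N] (W : WeierstrassCurve ℚ) (K : Type) [Field K] [NumberField K],
        Literature.NumberTheory.EllipticCurves.kolyvagin N W K) →
      ∀ (W : WeierstrassCurve ℚ) [W.IsElliptic] [W.IsGloballyMinimal] (p : ℕ) [Fact p.Prime],
      W.analyticRank = 1 → p ≠ 2 → ClassX3 W p → Additive.SubSemistableTwist W p →
      ∀ (N : ℕ) [NeZero N] (K : Type) [Field K] [NumberField K]
        (Dt : ModularParametrizationData W N) (H : HeegnerDatum N (NumberField.discr K)) (ι : K →+* ℂ)
        (P : (W.baseChange K).toAffine.Point),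
        W.analyticRank = 1 → Additive.N10.Locus W p → W.conductorNorm ℤ = N →
        ∀ hK : IsImaginaryQuadratic K,
        Odd (NumberField.discr K) → ¬ p ∣ Units.torsionOrder K → SatisfiesHeegnerHypothesis N K →
        (W.quadraticTwist (NumberField.discr K : ℚ)).entireLFunction 1 ≠ 0 →
        WeierstrassCurve.Affine.Point.map ι.toRatAlgHom P = heegnerPointComplex Dt H →
        ¬ IsOfFinAddOrder P →
        ∀ (κ : ZpExtension K p), κ.IsAnticyclotomic →
          ∀ (γ : Field.absoluteGaloisGroup K) [Fact (κ.IsTopGenerator γ)]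
            (𝔭 : HeightOneSpectrum (𝓞 K)) (h𝔭 : ((p : ℕ) : 𝓞 K) ∈ 𝔭.asIdeal)
            (he : 𝔭.asIdeal.ramificationIdx (𝓞 ℚ) = 1) (hf : 𝔭.asIdeal.inertiaDeg (𝓞 ℚ) = 1),
            ∀ g t : ℕ, Nat.card ((W.baseChange K).resOfLe p (le_top : κ.kerSubgroup ≤ ⊤)).ker = p ^ g →
            Nat.card (localKer κ.kerSubgroup ((W.baseChange K).geomPrimaryTorsion p) 𝔭) = p ^ t →
            ∃ a : ℕ, ((∃ _ : Finite (selmerAcBase (W.baseChange K) p 𝔭 ∅),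
                  Nat.card (selmerAcBase (W.baseChange K) p 𝔭 ∅) = p ^ a) ∧
                (a : ℤ) = (padicValNat p
                    (Nat.card (AddCommGroup.primaryComponent (W.baseChange K).sha p)) : ℤ) +
                  2 * (X11b.padicLogOrd W p (embAt K p 𝔭 h𝔭 he hf) P -
                    (padicValNat p (AddSubgroup.zmultiples P).index : ℤ)) +
                    padicValNat p (X11b.tamagawaProductAbove W K p) + g - t) := by
  intro hKo W _ _ p _ hr hp2 hX hS N _ K _ _ Dt H ι P hr' hloc hN hK hodd hunit hHe hL1 hP hnt κ hκ γ _ 𝔭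
    h𝔭 he hf g t hg ht
  have hp : p.Prime := Fact.out
  haveI : IsTotallyComplex K := hK.2
  haveI hEK : (W.baseChange K).IsElliptic := by rw [baseChange]; infer_instance
  have hpN : p ∣ W.conductorNorm ℤ := dvd_conductorNorm_of_n10Locus hloc
  have hsplit : SplitsIn K p := splitsIn_of_satisfiesHeegnerHypothesis hN hHe hpN
  obtain ⟨hrank, hSha⟩ := hKo N W K hK hHe ⟨Dt, H, ι, hP⟩ hnt
  -- `g = ord_p #E(K)[p^∞]`: `p^g = #ker res = #E_K[p^∞]^{Γ_K} = #E(K)[p^∞]`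
  set g₀ := padicValNat p (Nat.card (AddCommGroup.primaryComponent (W.baseChange K).toAffine.Point p))
    with hg₀def
  have hcardg := natCard_primaryComponent_point_eq_pow (W.baseChange K) p
  haveI := finite_fixedPoints_kerSubgroup_of_not_dvd_torsionOrder W p κ hp2 hK hunit hκ
  have hres : Nat.card ((W.baseChange K).resOfLe p (le_top : κ.kerSubgroup ≤ ⊤)).ker = p ^ g₀ := by
    rw [natCard_ker_resOfLe_top_eq_natCard_fixedPoints (W.baseChange K) p κ,
      natCard_fixedPoints_geomPrimaryTorsion_eq_natCard_primaryComponent (W.baseChange K) p, hcardg]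
  have hgg₀ : g = g₀ := Nat.pow_right_injective hp.two_le (hg.symm.trans hres)
  -- `t = t_p`: `p^t = #ker r_𝔭 = #E(ℚ_p)[p^∞]` (Fin_v + Brink Cor. 1 above `p`)
  obtain ⟨tp, htp⟩ := exists_natCard_primaryComponent_padic_eq_pow W p
  have h𝔭ker := natCard_localKer_eq_pow_of_finite W p κ 𝔭 h𝔭 he hf
    (hFinV W p hr hp2 hX hS K hK hsplit κ hκ 𝔭 h𝔭) (hBrA K p hK hp2 κ hκ 𝔭 h𝔭) htp
  have http : t = tp := Nat.pow_right_injective hp.two_le (ht.symm.trans h𝔭ker)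
  -- (P6-add-tors) at any `g`
  obtain ⟨hfin𝔭, a, hcard, ha⟩ := additiveBaseSelmerCountTors_of_rankOne_anyTorsion W p K (hPT K)
    (fun v ↦ localEulerPoincareCharacteristic_adicCompletionEP K v) hloc.2.1 hK hsplit hrank hSha P hnt
    𝔭 h𝔭 he hf
  have hcard' : Nat.card (selmerAcBase (W.baseChange K) p 𝔭 ∅) * p ^ tp = p ^ a := by
    rw [← htp]; exact hcard
  have hle : tp ≤ a :=
    (Nat.pow_dvd_pow_iff_le_right hp.one_lt).mp ⟨_, by rw [mul_comm]; exact hcard'.symm⟩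
  have hcardSel : Nat.card (selmerAcBase (W.baseChange K) p 𝔭 ∅) = p ^ (a - tp) := by
    have hsplitpow : p ^ a = p ^ (a - tp) * p ^ tp := by rw [← pow_add, Nat.sub_add_cancel hle]
    rw [hsplitpow] at hcard'
    exact Nat.eq_of_mul_eq_mul_right (pow_pos hp.pos tp) hcard'
  refine ⟨a - tp, ⟨hfin𝔭, hcardSel⟩, ?_⟩
  rw [Nat.cast_sub hle, ha, hgg₀, http]

/-- **The crux decl `AnticycControlAdditiveK` (item stmt-BirchSwinnertonDyer-19295) from the cited facts
and Fin_v on the cell** — gen 0's `anticycControlAdditiveK_of_facts_of_baseCountTors` with its single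
stub hypothesis now DISCHARGED by `stub_baseCountTors_of_facts`: `AnticycControlAdditiveK` ⇐
(∀ K, PT duality for Selmer structures) + (∀ K, PT duality for `Ш`) + (∀ K p, Brink Thm. 2) +
(∀ K p, Brink Cor. 1 above `p`) + item `LocalTowerTorsionFiniteX3` (stmt-BirchSwinnertonDyer-19546). So
under rev 9 the v3-K skeleton is complete modulo exactly the antecedents of `ControlFacts` and Fin_v — the
same inputs as the served crux `AnticycControlAdditiveKF` (door-c4 g3's hinge
`anticycControlAdditiveKF_of_finV_of_regimeB2`). CONDITIONAL (hypotheses BY NAME); BSD is not proved by this.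
[cite: JetchevSkinnerWan2017, Thm. 3.3.1 (arXiv:1512.06894 p. 11)] [cite: Brink2007, Thm. 2 and Cor. 1] -/
theorem anticycControlAdditiveK_of_facts_of_finV
    (hPT : ∀ (K : Type) [Field K] [NumberField K], poitouTate_selmerStructure_duality K)
    (hPT2 : ∀ (K : Type) [Field K] [NumberField K], poitouTate_sha_tateDual K)
    (hBr : ∀ (K : Type) [Field K] [NumberField K] (p : ℕ) [Fact p.Prime],
      ZpExtension.decomp_not_le_kerSubgroup_of_isAnticyclotomic K p)
    (hBrA : ∀ (K : Type) [Field K] [NumberField K] (p : ℕ) [Fact p.Prime],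
      ZpExtension.decomp_not_le_kerSubgroup_above_of_isAnticyclotomic K p)
    (hFinV : LocalTowerTorsionFiniteX3) :
    AnticycControlAdditiveK :=
  anticycControlAdditiveK_of_facts_of_baseCountTors hPT hPT2 hBr (stub_baseCountTors_of_facts hPT hBrA hFinV)

end StubBaseCountTors

end Summit.BirchSwinnertonDyer.BirchSwinnertonDyer.Theorems.SchneiderFreeAdditiveX3

end
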